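import Mathlib
import HarnessLib

/-!
# Route `SylvesterTwoHeegnerIndex` (rung K7t): DESCENT ALONG THE UNRAMIFIED QUADRATIC EXTENSION
# `ℤ₂[ω] ⊃ ℤ₂` — a `2`-primary `ℤ[ω]`-module with a conjugation-semilinear involution is
# base-changed from its invariants (LEMMA D ≡ two's LEMMA K0)

Cell `bsd-cm`, seat `bsd-cm-k7t-c2` (prover-bsd-cm-k7t-c2-g13-0; hand item 19229
`HeegnerIndexUpperAtTwoHSY`, verdict unchanged: NOT FOUND as a theorem). PARTITION (D-0054): CornerF at
`p = 2` (B14/O12) × 𝒞_HSY (`E_p : x³ + y³ = p`) × `p = 2` — types-the-object-of (the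
`ℤ₂[ω][Gal(ℚ(ω)/ℚ)]`-structure of `Ш(E_p/ℚ(ω))[2^∞]`, the object an `𝒪`-linear Kolyvagin argument over
the CM field bounds: ROAD (k), memo two §57, plan of record toward the registered stub
`stub_upperOffV0B_HSY` of item 19804 `UpperOffV0HSYPlus`); kernel helper
`--supports stmt-BirchSwinnertonDyer-19804 --as helper` (planner D296 GO); closes no cell and no item;
BSD is not claimed. Everything here is PROVED, abstract algebra over Mathlib: no definition, no named
fact, no instance, no notation, no `sorry`.

## What is proved (LEMMA D of memo `HOME/bsd-cm-k7t-c2/g13/K7T-INERT-DESCENT-k7t-c2-g13.md`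
## 1d481e4ab30a4a8d = addendum (5‴) to k7t-c2 memo v3 §4 (5″); = LEMMA K0 of memo two v2.12 §57.1,
## found independently the same hour — planner D296/D297: «two independent derivations agree»)

Data: an additive commutative group `M` on which `3` acts bijectively (e.g. ANY `2`-primary torsion
group: `three_zsmul_bijective_of_two_primary`), an additive endomorphism `w` with `w² + w + 1 = 0`
(a `ℤ[ω]`-module structure) and an additive involution `σ` with `σ ∘ w = w̄ ∘ σ`, `w̄ = −1 − w`
(`σ` is `ℤ[ω]`-semilinear for complex conjugation). Write `S = M^σ` (realised as the kernel of
`σ − id`), `T = M^{σ = −1}` (the kernel of `σ + id`) and `θ = id + 2w` («`√−3 = ω − ω̄`»).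

* `theta_theta` — `θ (θ x) = −3·x`; `theta_bijective`; `sigma_theta` — `σ θ = −θ σ`;
* `descent_injective`, `descent_surjective`, `descent_bijective` — the map `S × S → M`,
  `(s, t) ↦ s + w t`, is a GROUP ISOMORPHISM (explicit Galois descent along the unramified = étale
  extension `ℤ₂[ω] ⊃ ℤ₂`: `M ≅ ℤ[ω] ⊗_ℤ M^σ` with `σ = conj ⊗ 1`; inverse `t = θ⁻¹(m − σ m)`,
  `s = m − w t`);
* `card_eq_card_invariants_sq` — the SQUARE LAW `Nat.card M = (Nat.card S)²` (finite `M`: `#M = #S²`);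
* `mem_antiInvariants_iff` — `T = θ·S`: `σ x = −x ↔ ∃ s ∈ S, x = θ s`;
* `add_theta_eq_zero_iff` — the sum map `S ⊕ S → M`, `(s, s′) ↦ s + θ s′` (image `S + T`), has
  kernel `{(−s′, s′) : 2s′ = 0} ≅ S[2]`;
* `mem_sup_iff_two_dvd` — `S ⊔ T = {s + w t : s ∈ S, t ∈ 2S}`; `card_quotient_sup_eq` — the
  COKERNEL law `Nat.card (M ⧸ (S ⊔ T)) = Nat.card (S ⧸ 2S)`.

## The 𝒞_HSY reading (PAPER; the arithmetic wrapper — `𝒪`- and `σ`-actions on the tree's `Ш` over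
## `K₃` — is NOT in the tree, not offered, not commissioned)

For `E_p` (CM by `𝒪 = ℤ[ω]`, `K₃ = ℚ(ω)`, `2` INERT in `K₃`) take `M = Ш(E_p/K₃)[2^∞]` with `w = [ω]_*`
(`[ω] ∈ End_{K₃} E_p` commutes with `G_{K₃}`) and `σ` = complex conjugation acting on `H¹(K₃, E_p)`
(`σ[ω]σ⁻¹ = [ω̄]`). Then `#Ш(E_p/K₃)[2^∞] = (#Ш(E_p/K₃)[2^∞]^σ)²` and
`Ш(E_p/K₃)[2^∞]/(Ш⁺ + Ш⁻) ≅ Ш⁺/2`; with the cell item (L2) of k7t-c2 memo v3 (`p ≡ 4 (9)`: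
`Ш⁺ = res Ш(E_p/ℚ)[2^∞]`) this reads `ord₂ #Ш(E_p/K₃)[2^∞] = 2·ord₂ #Ш(E_p/ℚ)[2^∞]` EXACTLY and
`Ш(E_p/K₃)[2^∞]/(res Ш + ψres′Ш′) ≅ Ш(E_p)[2]`: the «maximally non-split» condition of the planner's
D294 (5) holds identically, and the twist term that killed line `offv0-kolyvagin2`
(`Cruxes/UpperOffV0HSYPlus/Lines/offv0-kolyvagin2-dead.md`) is ZERO in the CM frame (D296). It
bounds nothing: the sharp `𝒪`-linear Kolyvagin ORDER bound over `K₃` at the inert `2` — ROAD (k)'s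
whole remaining content — is untouched and open; B14 = O12 stays open as a class.

## References
* J.-P. Serre, *Local Fields*, GTM 67, X §1, Prop. 3 (Hilbert 90 ⇒ descent of vector spaces with a
  semilinear Galois action) — shape only; here the ring case `ℤ₂[ω]/ℤ₂` for torsion modules is done
  by hand in six lines.
* memo two v2.12 §22.2 (ii), §57.1 (bsd-cm-two): the same descent for `H¹(K, E_p[2^M])`, `Sel`, `Ш`.
-/

set_option autoImplicit false
set_option linter.dupNamespace false

namespace Summit.BirchSwinnertonDyer.BirchSwinnertonDyer.Theorems.SylvesterTwoUnramifiedDescent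

variable {M : Type*} [AddCommGroup M]

/-! ### `3` is bijective on a `2`-primary torsion group -/

/-- `3 ∣ 4 ^ n - 1`, stated without truncated subtraction: `4 ^ n = 3 * a + 1` for some `a`. -/
theorem four_pow_eq (n : ℕ) : ∃ a : ℕ, 4 ^ n = 3 * a + 1 := by
  induction n with
  | zero => exact ⟨0, by norm_num⟩
  | succ k ih =>
    obtain ⟨a, ha⟩ := ih
    exact ⟨4 * a + 1, by rw [pow_succ, ha]; ring⟩

/-- On an additive group in which every element is killed by a power of `2`, multiplication by `3`
is bijective (for `x` with `4ⁿ x = 0` and `4ⁿ = 3a + 1`, the inverse is `x ↦ (4ⁿ - a) • x`, since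
`3 (4ⁿ - a) = 2·4ⁿ + 1`). -/
theorem three_zsmul_bijective_of_two_primary (h2 : ∀ x : M, ∃ n : ℕ, (2 : ℤ) ^ n • x = 0) :
    Function.Bijective fun x : M => (3 : ℤ) • x := by
  -- key identity: for every `x` there is an integer `u` with `3 • (u • x) = x`
  have key : ∀ x : M, ∃ u : ℤ, (3 : ℤ) • (u • x) = x := by
    intro x
    obtain ⟨n, hn⟩ := h2 x
    obtain ⟨a, ha⟩ := four_pow_eq n
    have h4 : ((4 : ℤ) ^ n) • x = 0 := by
      have : ((4 : ℤ) ^ n) = (2 : ℤ) ^ n * (2 : ℤ) ^ n := by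
        rw [← mul_pow]; norm_num
      rw [this, mul_smul, hn, smul_zero]
    refine ⟨(4 : ℤ) ^ n - a, ?_⟩
    have ha' : ((4 : ℤ) ^ n) = 3 * (a : ℤ) + 1 := by exact_mod_cast ha
    rw [smul_smul]
    have : (3 : ℤ) * ((4 : ℤ) ^ n - a) = 2 * (4 : ℤ) ^ n + 1 := by rw [ha']; ring
    rw [this, add_smul, one_smul, mul_smul, h4, smul_zero, zero_add]
  constructor
  · intro x y hxy
    have h0 : (3 : ℤ) • (x - y) = 0 := by
      simp only [smul_sub, sub_eq_zero]; exact hxy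
    obtain ⟨u, hu⟩ := key (x - y)
    rw [smul_comm, h0, smul_zero] at hu
    exact sub_eq_zero.mp hu.symm
  · intro x
    obtain ⟨u, hu⟩ := key x
    exact ⟨u • x, hu⟩

/-! ### The element `θ = 1 + 2ω` -/

/-- `θ² = −3`: `(x + 2wx) + 2w(x + 2wx) = −3x` when `w² + w + 1 = 0`. -/
theorem theta_theta (w : M →+ M) (hw : ∀ x, w (w x) + w x + x = 0) (x : M) :
    (x + 2 • w x) + 2 • w (x + 2 • w x) = -(3 : ℤ) • x := by
  have h := hw x
  have e : w (w x) = -(w x) - x := by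
    rw [← sub_eq_zero]; rw [← h]; abel
  simp only [map_add, map_nsmul, e]
  module

/-- `θ = 1 + 2ω` is bijective as soon as `3` is. -/
theorem theta_bijective (w : M →+ M) (hw : ∀ x, w (w x) + w x + x = 0)
    (h3 : Function.Bijective fun x : M => (3 : ℤ) • x) :
    Function.Bijective fun x : M => x + 2 • w x := by
  have hm3 : Function.Bijective fun x : M => -(3 : ℤ) • x := by
    have : (fun x : M => -(3 : ℤ) • x) = (fun x : M => -x) ∘ fun x : M => (3 : ℤ) • x := by
      funext x; simp [neg_smul]
    rw [this]
    exact neg_bijective.comp h3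
  have hsq : (fun x : M => x + 2 • w x) ∘ (fun x : M => x + 2 • w x) =
      fun x : M => -(3 : ℤ) • x := by
    funext x; exact theta_theta w hw x
  constructor
  · -- injective: `θ ∘ θ` is injective
    have : Function.Injective ((fun x : M => x + 2 • w x) ∘ fun x : M => x + 2 • w x) := by
      rw [hsq]; exact hm3.injective
    exact this.of_comp
  · -- surjective: `θ ∘ θ` is surjective
    have : Function.Surjective ((fun x : M => x + 2 • w x) ∘ fun x : M => x + 2 • w x) := by
      rw [hsq]; exact hm3.surjective
    exact this.of_comp

/-- `σ θ = −θ σ` when `σ w = w̄ σ` with `w̄ = −1 − w`. -/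
theorem sigma_theta (w σ : M →+ M) (hσw : ∀ x, σ (w x) = -(σ x) - w (σ x)) (x : M) :
    σ (x + 2 • w x) = -(σ x + 2 • w (σ x)) := by
  simp only [map_add, map_nsmul, hσw]
  abel

/-! ### Invariants and anti-invariants -/

/-- Membership in `S = ker (σ − id)` is `σ x = x`. -/
theorem mem_ker_sub_id_iff (σ : M →+ M) (x : M) :
    x ∈ (σ - AddMonoidHom.id M).ker ↔ σ x = x := by
  rw [AddMonoidHom.mem_ker, AddMonoidHom.sub_apply, AddMonoidHom.id_apply, sub_eq_zero]

/-- Membership in `T = ker (σ + id)` is `σ x = −x`. -/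
theorem mem_ker_add_id_iff (σ : M →+ M) (x : M) :
    x ∈ (σ + AddMonoidHom.id M).ker ↔ σ x = -x := by
  rw [AddMonoidHom.mem_ker, AddMonoidHom.add_apply, AddMonoidHom.id_apply, add_eq_zero_iff_eq_neg]

/-! ### LEMMA D: `S × S → M`, `(s, t) ↦ s + w t` is a group isomorphism -/

/-- Injectivity of the descent map (needs only `θ` injective, i.e. here `3` bijective). -/
theorem descent_injective (w σ : M →+ M) (hw : ∀ x, w (w x) + w x + x = 0)
    (hσw : ∀ x, σ (w x) = -(σ x) - w (σ x))
    (h3 : Function.Bijective fun x : M => (3 : ℤ) • x) :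
    Function.Injective fun st : (σ - AddMonoidHom.id M).ker × (σ - AddMonoidHom.id M).ker =>
      (st.1 : M) + w st.2 := by
  intro ⟨s, t⟩ ⟨s', t'⟩ hst
  simp only at hst
  have hs := (mem_ker_sub_id_iff σ _).mp s.2
  have ht := (mem_ker_sub_id_iff σ _).mp t.2
  have hs' := (mem_ker_sub_id_iff σ _).mp s'.2
  have ht' := (mem_ker_sub_id_iff σ _).mp t'.2
  -- apply `σ` to `s + w t = s' + w t'`
  have hσ : (s : M) - t - w t = (s' : M) - t' - w t' := by
    have := congrArg σ hst
    simp only [map_add, hσw, hs, ht, hs', ht'] at this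
    rw [← sub_eq_zero] at this ⊢
    rw [← this]; abel
  -- subtracting gives `θ (t - t') = 0`
  have hθ : ((t : M) - t') + 2 • w ((t : M) - t') = 0 := by
    have e1 := sub_eq_zero.mpr hst
    have e2 := sub_eq_zero.mpr hσ
    have : ((s : M) + w t - (s' + w t')) - ((s : M) - t - w t - (s' - t' - w t')) = 0 := by
      rw [e1, e2, sub_zero]
    rw [← this, map_sub]; abel
  have hθ0 : (0 : M) + 2 • w (0 : M) = 0 := by simp
  have htt : (t : M) - t' = 0 := (theta_bijective w hw h3).injective (hθ.trans hθ0.symm)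
  have htt' : (t : M) = t' := sub_eq_zero.mp htt
  have hss' : (s : M) = s' := by
    have := hst; rw [htt'] at this; exact add_right_cancel this
  exact Prod.ext (Subtype.ext hss') (Subtype.ext htt')

/-- Surjectivity of the descent map: `m = s + w t` with `t = θ⁻¹ (m − σ m)`, `s = m − w t`. -/
theorem descent_surjective (w σ : M →+ M) (hw : ∀ x, w (w x) + w x + x = 0)
    (hσ : ∀ x, σ (σ x) = x) (hσw : ∀ x, σ (w x) = -(σ x) - w (σ x))
    (h3 : Function.Bijective fun x : M => (3 : ℤ) • x) :
    Function.Surjective fun st : (σ - AddMonoidHom.id M).ker × (σ - AddMonoidHom.id M).ker =>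
      (st.1 : M) + w st.2 := by
  intro m
  have hθ := theta_bijective w hw h3
  obtain ⟨t, ht⟩ := hθ.surjective (m - σ m)
  simp only at ht
  -- `σ t = t`: `θ (σ t) = -σ (θ t) = -(σ m - m) = θ t`
  have hσt : σ t = t := by
    apply hθ.injective
    simp only
    have h1 : σ (t + 2 • w t) = -(σ t + 2 • w (σ t)) := sigma_theta w σ hσw t
    rw [ht, map_sub, hσ] at h1
    rw [ht]
    have : σ t + 2 • w (σ t) = -(σ m - m) := by rw [← neg_neg (σ t + 2 • w (σ t)), ← h1]
    rw [this]; abel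
  have hσs : σ (m - w t) = m - w t := by
    rw [map_sub, hσw, hσt]
    -- `σ m + t + w t = m - w t` ⟸ `m - σ m = t + 2 • w t`
    rw [← sub_eq_zero]
    have e := sub_eq_zero.mpr ht
    rw [← e]; abel
  refine ⟨(⟨m - w t, (mem_ker_sub_id_iff σ _).mpr hσs⟩, ⟨t, (mem_ker_sub_id_iff σ _).mpr hσt⟩), ?_⟩
  simp

/-- **LEMMA D.** The descent map `S × S → M`, `(s, t) ↦ s + w t`, is bijective
(`M ≅ ℤ[ω] ⊗_ℤ M^σ`: explicit Galois descent along the unramified extension `ℤ₂[ω] ⊃ ℤ₂`). -/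
theorem descent_bijective (w σ : M →+ M) (hw : ∀ x, w (w x) + w x + x = 0)
    (hσ : ∀ x, σ (σ x) = x) (hσw : ∀ x, σ (w x) = -(σ x) - w (σ x))
    (h3 : Function.Bijective fun x : M => (3 : ℤ) • x) :
    Function.Bijective fun st : (σ - AddMonoidHom.id M).ker × (σ - AddMonoidHom.id M).ker =>
      (st.1 : M) + w st.2 :=
  ⟨descent_injective w σ hw hσw h3, descent_surjective w σ hw hσ hσw h3⟩

/-- (D1) `#M = (#M^σ)²` (as `Nat.card`; both sides are `0` when `M^σ` is infinite). -/
theorem card_eq_card_invariants_sq (w σ : M →+ M) (hw : ∀ x, w (w x) + w x + x = 0)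
    (hσ : ∀ x, σ (σ x) = x) (hσw : ∀ x, σ (w x) = -(σ x) - w (σ x))
    (h3 : Function.Bijective fun x : M => (3 : ℤ) • x) :
    Nat.card M = Nat.card (σ - AddMonoidHom.id M).ker ^ 2 := by
  rw [← Nat.card_congr (Equiv.ofBijective _ (descent_bijective w σ hw hσ hσw h3)),
    Nat.card_prod, sq]

/-- (D2) The anti-invariants are `θ·S`: `σ x = −x ↔ x = θ s` for some `σ`-invariant `s`. -/
theorem mem_antiInvariants_iff (w σ : M →+ M) (hw : ∀ x, w (w x) + w x + x = 0)
    (hσ : ∀ x, σ (σ x) = x) (hσw : ∀ x, σ (w x) = -(σ x) - w (σ x))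
    (h3 : Function.Bijective fun x : M => (3 : ℤ) • x) (x : M) :
    x ∈ (σ + AddMonoidHom.id M).ker ↔
      ∃ s ∈ (σ - AddMonoidHom.id M).ker, x = s + 2 • w s := by
  rw [mem_ker_add_id_iff]
  constructor
  · intro hx
    obtain ⟨⟨s, t⟩, hst⟩ := descent_surjective w σ hw hσ hσw h3 x
    simp only at hst
    have hs := (mem_ker_sub_id_iff σ _).mp s.2
    have ht := (mem_ker_sub_id_iff σ _).mp t.2
    -- `σ x = s - t - w t = -(s + w t)` forces `t = 2 s` by uniqueness of the decomposition
    have hσx : σ x = (s : M) - t - w t := by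
      rw [← hst, map_add, hσw, hs, ht]; abel
    -- comparing with `σ x = -x = -(s + w t)` gives `2 s - t = 0`, i.e. `t = s + s`
    have ht2 : (t : M) = s + s := by
      have e : (s : M) - t - w t = -((s : M) + w t) := by rw [← hσx, hx, hst]
      rw [← sub_eq_zero] at e
      rw [eq_comm, ← sub_eq_zero, ← e]; abel
    refine ⟨s, s.2, ?_⟩
    rw [← hst, ht2, map_add, two_nsmul]
  · rintro ⟨s, hs, rfl⟩
    have hs' := (mem_ker_sub_id_iff σ _).mp hs
    rw [sigma_theta w σ hσw, hs']

/-- (D3, kernel) For `σ`-invariant `s, s'`: `s + θ s' = 0 ↔ s = −s' ∧ 2 s' = 0`, i.e. the sum map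
`S ⊕ S → M`, `(s, s') ↦ s + θ s'` (whose image is `S + T`) has kernel `≅ S[2]`. -/
theorem add_theta_eq_zero_iff (w σ : M →+ M) (hw : ∀ x, w (w x) + w x + x = 0)
    (hσw : ∀ x, σ (w x) = -(σ x) - w (σ x))
    (h3 : Function.Bijective fun x : M => (3 : ℤ) • x)
    {s s' : M} (hs : σ s = s) (hs' : σ s' = s') :
    s + (s' + 2 • w s') = 0 ↔ s = -s' ∧ 2 • s' = 0 := by
  constructor
  · intro h
    -- `s + θ s' = (s + s') + w (2 s')`; uniqueness of the decomposition
    have hss : σ (s + s') = s + s' := by rw [map_add, hs, hs']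
    have h2 : σ (2 • s') = 2 • s' := by rw [map_nsmul, hs']
    have key : (s + s') + w (2 • s') = (0 : M) + w 0 := by
      rw [map_zero, zero_add, map_nsmul, ← h]; abel
    have hinj := descent_injective w σ hw hσw h3
      (a₁ := (⟨s + s', (mem_ker_sub_id_iff σ _).mpr hss⟩, ⟨2 • s', (mem_ker_sub_id_iff σ _).mpr h2⟩))
      (a₂ := (⟨0, zero_mem _⟩, ⟨0, zero_mem _⟩)) (by simpa using key)
    simp only [Prod.mk.injEq, Subtype.mk.injEq] at hinj
    exact ⟨eq_neg_of_add_eq_zero_left hinj.1, hinj.2⟩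
  · rintro ⟨rfl, h2⟩
    rw [two_nsmul] at h2
    have : 2 • w s' = 0 := by rw [two_nsmul, ← map_add, h2, map_zero]
    rw [this, add_zero, neg_add_cancel]

/-- (D3, image) `S ⊔ T = {s + w t : s ∈ S, t ∈ 2S}`: an element `s + w t` (`s, t` `σ`-invariant) lies
in `S + T` iff `t` is divisible by `2` inside `S`. -/
theorem mem_sup_iff_two_dvd (w σ : M →+ M) (hw : ∀ x, w (w x) + w x + x = 0)
    (hσ : ∀ x, σ (σ x) = x) (hσw : ∀ x, σ (w x) = -(σ x) - w (σ x))
    (h3 : Function.Bijective fun x : M => (3 : ℤ) • x)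
    {s t : M} (hs : σ s = s) (ht : σ t = t) :
    s + w t ∈ (σ - AddMonoidHom.id M).ker ⊔ (σ + AddMonoidHom.id M).ker ↔
      ∃ t', σ t' = t' ∧ t = 2 • t' := by
  constructor
  · intro h
    obtain ⟨a, ha, b, hb, hab⟩ := AddSubgroup.mem_sup.mp h
    have ha' := (mem_ker_sub_id_iff σ _).mp ha
    obtain ⟨c, hc, rfl⟩ := (mem_antiInvariants_iff w σ hw hσ hσw h3 b).mp hb
    have hc' := (mem_ker_sub_id_iff σ _).mp hc
    -- `a + θ c = (a + c) + w (2c) = s + w t` ⇒ `t = 2c`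
    have hac : σ (a + c) = a + c := by rw [map_add, ha', hc']
    have h2c : σ (2 • c) = 2 • c := by rw [map_nsmul, hc']
    have key : (a + c) + w (2 • c) = s + w t := by rw [← hab, map_nsmul]; abel
    have hinj := descent_injective w σ hw hσw h3
      (a₁ := (⟨a + c, (mem_ker_sub_id_iff σ _).mpr hac⟩, ⟨2 • c, (mem_ker_sub_id_iff σ _).mpr h2c⟩))
      (a₂ := (⟨s, (mem_ker_sub_id_iff σ _).mpr hs⟩, ⟨t, (mem_ker_sub_id_iff σ _).mpr ht⟩))
      (by simpa using key)
    simp only [Prod.mk.injEq, Subtype.mk.injEq] at hinj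
    exact ⟨c, hc', hinj.2.symm⟩
  · rintro ⟨c, hc, rfl⟩
    -- `s + w (2c) = (s - c) + θ c`
    have h1 : s - c ∈ (σ - AddMonoidHom.id M).ker :=
      (mem_ker_sub_id_iff σ _).mpr (by rw [map_sub, hs, hc])
    have h2 : c + 2 • w c ∈ (σ + AddMonoidHom.id M).ker :=
      (mem_antiInvariants_iff w σ hw hσ hσw h3 _).mpr ⟨c, (mem_ker_sub_id_iff σ _).mpr hc, rfl⟩
    have : s + w (2 • c) = (s - c) + (c + 2 • w c) := by rw [map_nsmul]; abel
    rw [this]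
    exact AddSubgroup.add_mem_sup h1 h2

/-- (D3, cokernel) `#(M ⧸ (S + T)) = #(S ⧸ 2S)`: the cokernel of the sum map `S ⊕ S → M`,
`(s, s') ↦ s + θ s'`, is `S/2S` (so for finite `S` it is an `𝔽₂`-space of dimension `dim S[2]`). The
isomorphism is `m = s + w t ↦ t mod 2S`. -/
theorem card_quotient_sup_eq (w σ : M →+ M) (hw : ∀ x, w (w x) + w x + x = 0)
    (hσ : ∀ x, σ (σ x) = x) (hσw : ∀ x, σ (w x) = -(σ x) - w (σ x))
    (h3 : Function.Bijective fun x : M => (3 : ℤ) • x) :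
    Nat.card (M ⧸ ((σ - AddMonoidHom.id M).ker ⊔ (σ + AddMonoidHom.id M).ker)) =
      Nat.card (↥(σ - AddMonoidHom.id M).ker ⧸
        (nsmulAddMonoidHom (α := ↥(σ - AddMonoidHom.id M).ker) 2).range) := by
  set S := (σ - AddMonoidHom.id M).ker with hS
  set T := (σ + AddMonoidHom.id M).ker with hT
  -- the descent map as an additive isomorphism `S × S ≃+ M`
  let Φ : S × S →+ M := S.subtype.coprod (w.comp S.subtype)
  have hΦ' : (Φ : S × S → M) = fun st => (st.1 : M) + w st.2 := by
    funext st
    simp only [Φ, AddMonoidHom.coprod_apply, AddSubgroup.coe_subtype, AddMonoidHom.coe_comp,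
      Function.comp_apply]
  have hΦ : Function.Bijective Φ := by
    rw [hΦ']; exact descent_bijective w σ hw hσ hσw h3
  let e : S × S ≃+ M := AddEquiv.ofBijective Φ hΦ
  have he : ∀ st : S × S, e st = (st.1 : M) + w st.2 := by
    intro st
    change Φ st = _
    rw [hΦ']
  let K : AddSubgroup S := (nsmulAddMonoidHom (α := S) 2).range
  -- `ψ : M → S/2S`, `s + w t ↦ t mod 2S`
  let ψ : M →+ S ⧸ K :=
    ((QuotientAddGroup.mk' K).comp (AddMonoidHom.snd S S)).comp e.symm.toAddMonoidHom
  have hψ : ∀ st : S × S, ψ (e st) = QuotientAddGroup.mk' K st.2 := by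
    intro st
    simp only [ψ, AddMonoidHom.coe_comp, Function.comp_apply, AddEquiv.coe_toAddMonoidHom,
      AddEquiv.symm_apply_apply, AddMonoidHom.coe_snd]
  have hψs : Function.Surjective ψ := by
    intro q
    obtain ⟨t, rfl⟩ := QuotientAddGroup.mk'_surjective K q
    exact ⟨e (0, t), hψ (0, t)⟩
  have hker : ψ.ker = S ⊔ T := by
    ext m
    obtain ⟨⟨s, t⟩, rfl⟩ := e.surjective m
    rw [AddMonoidHom.mem_ker, hψ, QuotientAddGroup.mk'_apply, QuotientAddGroup.eq_zero_iff, he]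
    have hs := (mem_ker_sub_id_iff σ _).mp s.2
    have ht := (mem_ker_sub_id_iff σ _).mp t.2
    rw [mem_sup_iff_two_dvd w σ hw hσ hσw h3 hs ht]
    constructor
    · rintro ⟨t', ht'⟩
      rw [nsmulAddMonoidHom_apply] at ht'
      refine ⟨t', (mem_ker_sub_id_iff σ _).mp t'.2, ?_⟩
      have h2 := congrArg Subtype.val ht'
      simpa using h2.symm
    · rintro ⟨t', hσt', htt'⟩
      refine ⟨⟨t', (mem_ker_sub_id_iff σ _).mpr hσt'⟩, ?_⟩
      rw [nsmulAddMonoidHom_apply]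
      exact Subtype.ext (by simpa using htt'.symm)
  calc Nat.card (M ⧸ (S ⊔ T)) = Nat.card (M ⧸ ψ.ker) := by rw [hker]
    _ = Nat.card (S ⧸ K) :=
        Nat.card_congr (QuotientAddGroup.quotientKerEquivOfSurjective ψ hψs).toEquiv

end Summit.BirchSwinnertonDyer.BirchSwinnertonDyer.Theorems.SylvesterTwoUnramifiedDescent
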